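import Literature.NumberTheory.Automorphic.UnipotentConvAbsorption
import Literature.NumberTheory.Automorphic.GL2NewvectorGaussSumOperator
import HarnessLib

/-!
# Moving a derivative past the archimedean torus translate: `Ad(a(y)⁻¹)` on the letters of `𝔤𝔩₂`

Topic `NumberTheory/Automorphic`; namespace `Literature.NumberTheory.Automorphic`. Proof file (three
auxiliary definitions with bodies — `lowerDirGL2`, `diagDirGL2`, `archDilationGL` —, theorems). For a test function `θ` on `GL_2(𝔸_K)` and the
archimedean torus element `a(y) = (diag(y, 1), 1)`, `y ∈ K_∞ˣ` (`archDilationAdelic`), the rule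
`(L_g θ)_X = L_g (θ_{Ad(g_∞⁻¹) X})` (`derivWeight_leftTranslateWeight`) is made explicit on the three
kinds of letters of `𝔤 = M_2(K_∞) = K_∞ E ⊕ 𝔡 ⊕ K_∞ F` (`E = E₁₂`, `F = E₂₁`, `𝔡` the diagonal
matrices):

* `archConjCLM_diagGL2_unipotentDir` / `_lowerDir` / `_diagDir` —
  `Ad(a(y)⁻¹)(c E) = (y⁻¹ c) E`, `Ad(a(y)⁻¹)(z F) = (y z) F`, `Ad(a(y)⁻¹) D = D`;
* `derivWeight_leftTranslate_archDilation_lowerDir` — **`(L_{a(y)} θ)_{zF} = L_{a(y)} (θ_{(yz)F})`**,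
  and its expansion in the real basis `stdBasis K` of `K_∞`,
  `(L_{a(y)} θ)_{zF} = ∑_b (y z)_b · L_{a(y)} (θ_{b F})` (`…_lowerDir_expand`): the letter `F` costs
  ONE power of the torus variable;
* `derivWeight_leftTranslate_archDilation_diagDir` — `(L_{a(y)} θ)_D = L_{a(y)} (θ_D)`: diagonal
  letters cost nothing;
* `derivWeight_split_letters` — `θ'_X = θ'_{X₀₁ E} + θ'_{D(X)} + θ'_{X₁₀ F}` for any test function `θ'`
  (the `E`-part is the one absorbed by the convolution kernel, `archUnipotentConv_derivWeight_smul_matE`).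

This is the bookkeeping of weights in the Kirillov `L²`-bound along the archimedean torus
(Jacquet–Shalika (1981), §4; Bump (1997), §2.2 and the `GL_2(ℝ)` Kirillov model, §2.8).

## References

* H. Jacquet, J. A. Shalika, *On Euler products and the classification of automorphic
  representations I*, Amer. J. Math. 103 (1981), §4 [JacquetShalikaAJM1981].
* D. Bump, *Automorphic Forms and Representations* (1997), §2.2 (2.28)–(2.29), §2.8 [Bump1997].
-/

noncomputable section

open scoped MatrixGroups Classical ContDiff
open NumberField NumberField.mixedEmbedding IsDedekindDomain MeasureTheory

namespace Literature.NumberTheory.Automorphic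

variable {K : Type} [Field K] [NumberField K]
  (hcpt : isCompact_glFiniteIntegralLevel 2 K)

set_option backward.isDefEq.respectTransparency false

attribute [local instance 100] LieRing.ofAssociativeRing

open scoped Matrix.Norms.Operator

/-! ### The letters `F`, `D` and the decomposition of `𝔤𝔩₂` -/

/-- The direction `z ↦ z F = (0 0; z 0)` of the lower unipotent line, a real linear map. [folklore] -/
def lowerDirGL2 : mixedSpace K →ₗ[ℝ] Matrix (Fin 2) (Fin 2) (mixedSpace K) where
  toFun z := Matrix.of ![![0, 0], ![z, 0]]
  map_add' a b := by
    refine Matrix.ext fun i j => ?_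
    fin_cases i <;> fin_cases j <;> simp
  map_smul' c a := by
    refine Matrix.ext fun i j => ?_
    fin_cases i <;> fin_cases j <;> simp

/-- The diagonal letter `D(d₀, d₁) = (d₀ 0; 0 d₁)`. [folklore] -/
def diagDirGL2 (d₀ d₁ : mixedSpace K) : Matrix (Fin 2) (Fin 2) (mixedSpace K) := Matrix.of ![![d₀, 0], ![0, d₁]]

omit [NumberField K] in
/-- **`𝔤𝔩₂ = K_∞ E ⊕ 𝔡 ⊕ K_∞ F`**: `X = X₀₁ E + D(X₀₀, X₁₁) + X₁₀ F`. [folklore] -/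
theorem matrix_eq_unipotentDir_add_diagDir_add_lowerDir (X : Matrix (Fin 2) (Fin 2) (mixedSpace K)) :
    X = unipotentDirGL2 (X 0 1) + diagDirGL2 (X 0 0) (X 1 1) + lowerDirGL2 (X 1 0) := by
  refine Matrix.ext fun i j => ?_
  fin_cases i <;> fin_cases j <;> simp [unipotentDirGL2, diagDirGL2, lowerDirGL2]

omit [NumberField K] in
/-- **`Ad(a(y)⁻¹)(c E) = (y⁻¹ c) E`**: the upper unipotent letter is dilated by `y⁻¹`. [folklore] -/
theorem archConjCLM_diagGL2_unipotentDir (y : (mixedSpace K)ˣ) (c : mixedSpace K) :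
    archConjCLM (diagGL2 y 1) (unipotentDirGL2 c) = unipotentDirGL2 (((y⁻¹ : (mixedSpace K)ˣ) : mixedSpace K) * c) := by
  rw [archConjCLM_apply, diagGL2_one_inv, coe_diagGL2, coe_diagGL2]
  refine Matrix.ext fun i j => ?_
  fin_cases i <;> fin_cases j <;> simp [unipotentDirGL2, Matrix.mul_apply, Fin.sum_univ_two]

omit [NumberField K] in
/-- **`Ad(a(y)⁻¹)(z F) = (y z) F`**: the lower unipotent letter is contracted by `y`. [folklore] -/
theorem archConjCLM_diagGL2_lowerDir (y : (mixedSpace K)ˣ) (z : mixedSpace K) :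
    archConjCLM (diagGL2 y 1) (lowerDirGL2 z) = lowerDirGL2 ((y : mixedSpace K) * z) := by
  rw [archConjCLM_apply, diagGL2_one_inv, coe_diagGL2, coe_diagGL2]
  refine Matrix.ext fun i j => ?_
  fin_cases i <;> fin_cases j <;> simp [lowerDirGL2, Matrix.mul_apply, Fin.sum_univ_two, mul_comm]

omit [NumberField K] in
/-- `y⁻¹ d y = d` in the commutative ring `K_∞`. [folklore] -/
private theorem units_inv_mul_mul_cancel (y : (mixedSpace K)ˣ) (d : mixedSpace K) :
    ((y⁻¹ : (mixedSpace K)ˣ) : mixedSpace K) * d * y = d := by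
  rw [mul_comm, ← mul_assoc, Units.mul_inv, one_mul]

omit [NumberField K] in
/-- **`Ad(a(y)⁻¹) D = D`** for a diagonal letter. [folklore] -/
theorem archConjCLM_diagGL2_diagDir (y : (mixedSpace K)ˣ) (d₀ d₁ : mixedSpace K) :
    archConjCLM (diagGL2 y 1) (diagDirGL2 d₀ d₁) = diagDirGL2 d₀ d₁ := by
  rw [archConjCLM_apply, diagGL2_one_inv, coe_diagGL2, coe_diagGL2]
  refine Matrix.ext fun i j => ?_
  fin_cases i <;> fin_cases j <;>
    simp [-Units.val_inv_eq_inv_val, diagDirGL2, Matrix.mul_apply, Fin.sum_univ_two, units_inv_mul_mul_cancel]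

/-! ### The torus translate -/

variable (K) in
/-- `a(y) = (diag(y, 1), 1) ∈ GL_2(𝔸_K)`, `GL`-typed (reducibly `archDilationAdelic K y`). [folklore] -/
abbrev archDilationGL (y : (mixedSpace K)ˣ) : GL (Fin 2) (AdeleRing (𝓞 K) K) := archDilationAdelic K y

/-- The archimedean component of `a(y)` is `diag(y, 1)`. [folklore] -/
theorem toMixed_archDilationGL (y : (mixedSpace K)ˣ) : GLn.toMixed 2 K (archDilationGL K y) = diagGL2 y 1 :=
  GLn.toMixed_ofInfinite _

/-- **`(L_{a(y)} θ)_{zF} = L_{a(y)} (θ_{(yz)F})`** for a test function `θ`: moving the lower letter past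
the torus translate contracts it by `y`. [cite: JacquetShalikaAJM1981, §4] -/
theorem derivWeight_leftTranslate_archDilation_lowerDir {θ : GL (Fin 2) (AdeleRing (𝓞 K) K) → ℝ}
    (hθ : IsTestFunctionGL 2 K θ) (y : (mixedSpace K)ˣ) (z : mixedSpace K) :
    derivWeight (AutomorphyDatum.gl 2 K hcpt).ofArch (toLie hcpt (lowerDirGL2 z))
        (leftTranslateWeight (n := 2) (archDilationGL K y) θ) =
      leftTranslateWeight (n := 2) (archDilationGL K y)
        (derivWeight (AutomorphyDatum.gl 2 K hcpt).ofArch (toLie hcpt (lowerDirGL2 ((y : mixedSpace K) * z))) θ) := by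
  rw [derivWeight_leftTranslateWeight hcpt hθ, toMixed_archDilationGL]
  congr 2
  exact Subtype.ext (archConjCLM_diagGL2_lowerDir y z)

/-- **`(L_{a(y)} θ)_D = L_{a(y)} (θ_D)`** for a diagonal letter `D` and a test function `θ`. [folklore] -/
theorem derivWeight_leftTranslate_archDilation_diagDir {θ : GL (Fin 2) (AdeleRing (𝓞 K) K) → ℝ}
    (hθ : IsTestFunctionGL 2 K θ) (y : (mixedSpace K)ˣ) (d₀ d₁ : mixedSpace K) :
    derivWeight (AutomorphyDatum.gl 2 K hcpt).ofArch (toLie hcpt (diagDirGL2 d₀ d₁))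
        (leftTranslateWeight (n := 2) (archDilationGL K y) θ) =
      leftTranslateWeight (n := 2) (archDilationGL K y)
        (derivWeight (AutomorphyDatum.gl 2 K hcpt).ofArch (toLie hcpt (diagDirGL2 d₀ d₁)) θ) := by
  rw [derivWeight_leftTranslateWeight hcpt hθ, toMixed_archDilationGL]
  congr 2
  exact Subtype.ext (archConjCLM_diagGL2_diagDir y d₀ d₁)

/-- **`(L_{a(y)} θ)_{cE} = L_{a(y)} (θ_{(y⁻¹c)E})`** (recorded for completeness; in the Kirillov bound the
`E`-letters are absorbed by the kernel before meeting the torus translate). [folklore] -/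
theorem derivWeight_leftTranslate_archDilation_unipotentDir {θ : GL (Fin 2) (AdeleRing (𝓞 K) K) → ℝ}
    (hθ : IsTestFunctionGL 2 K θ) (y : (mixedSpace K)ˣ) (c : mixedSpace K) :
    derivWeight (AutomorphyDatum.gl 2 K hcpt).ofArch (toLie hcpt (unipotentDirGL2 c))
        (leftTranslateWeight (n := 2) (archDilationGL K y) θ) =
      leftTranslateWeight (n := 2) (archDilationGL K y)
        (derivWeight (AutomorphyDatum.gl 2 K hcpt).ofArch
          (toLie hcpt (unipotentDirGL2 (((y⁻¹ : (mixedSpace K)ˣ) : mixedSpace K) * c))) θ) := by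
  rw [derivWeight_leftTranslateWeight hcpt hθ, toMixed_archDilationGL]
  congr 2
  exact Subtype.ext (archConjCLM_diagGL2_unipotentDir y c)

/-- Expansion of a lower letter in the real basis: `(x) F = ∑_b x_b (b F)` in `𝔤`. [folklore] -/
theorem toLie_lowerDir_eq_sum (x : mixedSpace K) :
    toLie hcpt (lowerDirGL2 x) = ∑ b, (stdBasis K).repr x b • toLie hcpt (lowerDirGL2 (stdBasis K b)) := by
  refine Subtype.ext ?_
  rw [AddSubmonoidClass.coe_finsetSum]
  show lowerDirGL2 x = ∑ b, (((stdBasis K).repr x b • toLie hcpt (lowerDirGL2 (stdBasis K b)) :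
    (AutomorphyDatum.gl 2 K hcpt).arch.lie) : Matrix (Fin 2) (Fin 2) (mixedSpace K))
  conv_lhs => rw [← (stdBasis K).sum_repr x]
  rw [map_sum]
  refine Finset.sum_congr rfl fun b _ => ?_
  rw [map_smul]
  rfl

/-- **`(L_{a(y)} θ)_{zF} = ∑_b (y z)_b · L_{a(y)} (θ_{bF})`**: the lower letter costs one power of the
torus variable, with FIXED letters `b F`, `b ∈ stdBasis K`. [cite: JacquetShalikaAJM1981, §4] -/
theorem derivWeight_leftTranslate_archDilation_lowerDir_expand {θ : GL (Fin 2) (AdeleRing (𝓞 K) K) → ℝ}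
    (hθ : IsTestFunctionGL 2 K θ) (y : (mixedSpace K)ˣ) (z : mixedSpace K) :
    derivWeight (AutomorphyDatum.gl 2 K hcpt).ofArch (toLie hcpt (lowerDirGL2 z))
        (leftTranslateWeight (n := 2) (archDilationGL K y) θ) =
      ∑ b, (stdBasis K).repr ((y : mixedSpace K) * z) b •
        leftTranslateWeight (n := 2) (archDilationGL K y)
          (derivWeight (AutomorphyDatum.gl 2 K hcpt).ofArch (toLie hcpt (lowerDirGL2 (stdBasis K b))) θ) := by
  rw [derivWeight_leftTranslate_archDilation_lowerDir hcpt hθ, toLie_lowerDir_eq_sum hcpt,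
    derivWeight_sum_lie hcpt hθ, leftTranslateWeight_sum]
  refine Finset.sum_congr rfl fun b _ => ?_
  rw [leftTranslateWeight_smul]

/-! ### Splitting a letter -/

/-- **`θ'_X = θ'_{X₀₁ E} + θ'_{D(X)} + θ'_{X₁₀ F}`** for a test function `θ'` (`ℝ`-linearity of the
derivative in the letter and `𝔤𝔩₂ = K_∞E ⊕ 𝔡 ⊕ K_∞F`). [folklore] -/
theorem derivWeight_split_letters {θ' : GL (Fin 2) (AdeleRing (𝓞 K) K) → ℝ} (hθ' : IsTestFunctionGL 2 K θ')
    (X : (AutomorphyDatum.gl 2 K hcpt).arch.lie) :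
    derivWeight (AutomorphyDatum.gl 2 K hcpt).ofArch X θ' =
      derivWeight (AutomorphyDatum.gl 2 K hcpt).ofArch
          (toLie hcpt (((X : Matrix (Fin 2) (Fin 2) (mixedSpace K)) 0 1) • (matE : Matrix (Fin 2) (Fin 2) (mixedSpace K)))) θ' +
        derivWeight (AutomorphyDatum.gl 2 K hcpt).ofArch
          (toLie hcpt (diagDirGL2 ((X : Matrix (Fin 2) (Fin 2) (mixedSpace K)) 0 0)
            ((X : Matrix (Fin 2) (Fin 2) (mixedSpace K)) 1 1))) θ' +
        derivWeight (AutomorphyDatum.gl 2 K hcpt).ofArch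
          (toLie hcpt (lowerDirGL2 ((X : Matrix (Fin 2) (Fin 2) (mixedSpace K)) 1 0))) θ' := by
  have hX : X = toLie hcpt (((X : Matrix (Fin 2) (Fin 2) (mixedSpace K)) 0 1) • (matE : Matrix (Fin 2) (Fin 2) (mixedSpace K))) +
      toLie hcpt (diagDirGL2 ((X : Matrix (Fin 2) (Fin 2) (mixedSpace K)) 0 0) ((X : Matrix (Fin 2) (Fin 2) (mixedSpace K)) 1 1)) +
      toLie hcpt (lowerDirGL2 ((X : Matrix (Fin 2) (Fin 2) (mixedSpace K)) 1 0)) := by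
    refine Subtype.ext ?_
    show (X : Matrix (Fin 2) (Fin 2) (mixedSpace K)) = ((X : Matrix (Fin 2) (Fin 2) (mixedSpace K)) 0 1) • matE +
      diagDirGL2 ((X : Matrix (Fin 2) (Fin 2) (mixedSpace K)) 0 0) ((X : Matrix (Fin 2) (Fin 2) (mixedSpace K)) 1 1) +
      lowerDirGL2 ((X : Matrix (Fin 2) (Fin 2) (mixedSpace K)) 1 0)
    rw [smul_matE]
    exact matrix_eq_unipotentDir_add_diagDir_add_lowerDir _
  conv_lhs => rw [hX]
  rw [derivWeight_add_lie hcpt hθ', derivWeight_add_lie hcpt hθ']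

end Literature.NumberTheory.Automorphic
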